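/-
Copyright (c) 2026 the pub-hodgecm-mathlib formalisation cell (harness21).  Prover seat hodgecm-mathlib-K2E1-p08 (g6), Track B ∕ K2-LIT
(build stream 29), h413 = `stmt-HodgeConjecture-24833`, line `K2_E1_TraceFormulaBeta`, campaign «EIS-R7-BL-SPH-2» (Bernstein–Lapid soft continuation of
the spherical Borel Eisenstein series of `U(1,1)`), file «BL-R1» (part 3: the weighted corollary for P2a's `IotaBound`); dealer K2E1-plan (g5) «YES» 2026-09-04T08:39:25Z.
-/
import Summits.HodgeConjecture.HodgeConjecture.Theorems.K2E1BLReductionCoveringU2            -- K2E1-p08 (g6), parts 1–2: Siegel consequences, `w₁`, covering, multiplicity bound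
import HarnessLib

/-!
# h413 ∕ Track B «K2-LIT», campaign «EIS-R7-BL-SPH-2» — helper `K2E1BLIotaWeightBoundU2` («BL-R1», part 3): THE FIBRE WEIGHT OF `p_c : Z_c → 𝔛` IS COMPARABLE TO
# `w₁^{−m}` — `w₁(x)^{−m} ≤ Σ_{q ∈ B(F)∖G(F), H(q̃x) > c} H(q̃ x)^{−m} ≤ C' · w₁(x)^{−m}` (the two inequalities behind «`ι_{c,k}` is a closed embedding»)

Cell `pub/hodgecm-mathlib`, crux H413 = `stmt-HodgeConjecture-24833`, route of record `HCCMUnconditional`; chair K2-lead (g1), dealer K2E1-plan (g5) («YES to the weighted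
corollary — P2a's `iota` bound wants exactly it», 08:39:25Z); spec of record = K2E1b-plan (g6) WIRING «EIS-R7-BL-SPH-2» `7d1cceb628a30de8` §3 P2a ∕ §5 R1 (Bernstein–Lapid
[arXiv:1911.02342, §4 Claim 4 bullet 1 p. 10]: «the pull-back `ι_{c,N} : 𝓗_N(𝔛) → 𝓗_N(Z_c)` along the surjective `p_c` is a closed embedding» — unfolded along the fibres
`p_c⁻¹[g] = {N(F)·q̃g : H(q̃ g) > c}` of `p_c`, `‖ι f‖² = ∫_𝔛 |f|² · Σ_{q, H(q̃g) > c} H(q̃g)^{−2N}` against `‖f‖² = ∫_𝔛 |f|² w₁^{−2N}`, so boundedness AND closed range of `ι` are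
the two pointwise inequalities of this file with `m = 2N`; the measure-theoretic unfolding itself is P2a, K2E4-p10).  THEOREMS ONLY (no `def`, no `instance`, no `notation`, no
named-fact hypothesis, no `sorry`); lane `--kind proof --supports stmt-HodgeConjecture-24833 --as helper` (count-neutral).  Mok's datum `quasiSplit F E c 2`, `G(F) = arithmeticSubgroup`,
`B(F) = arithmeticBorel`, `H = borelHeight`, cosets `Quotient (QuotientGroup.rightRel (arithmeticBorel F E c 2))` with representatives `q̃ = q.out`, the finite set
`S_c(x) = {q ∣ c < H(q̃ x)}` (★ `finite_setOf_lt_borelHeight_two`) summed as `Finset.sum` over `hfin.toFinset`, weights `(H(q̃ x))⁻¹ ^ m` in `ℝ≥0` (`m : ℕ`; P2's `𝓗_k` uses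
`m = 2k`), `w₁(x) = ⨆_{γ ∈ G(F)} H(γ x)` (★ part 1: finite, attained, `G(F)`-invariant).

* §1 `mk_out_mul` (`B(F)·((B(F)·a).out · b) = B(F)·(a b)`), **`sum_setOf_lt_borelHeight_mul_eq`** — the fibre sum is `G(F)`-INVARIANT: `Σ_{q ∈ S_c(γ₁ y)} φ(H(q̃ γ₁ y)) = Σ_{q ∈ S_c(y)} φ(H(q̃ y))`
  for ANY `φ` (`Finset.sum_bij'` along `q ↦ B(F)·(q̃ γ₁)`, ★ `borelHeight_out_mk_mul_two`).
* §2 (every `E∕F`) **`ciSup_inv_pow_le_sum_of_lt_ciSup`** — LOWER BOUND: if `c < w₁(x)` then `w₁(x)^{−m} ≤ Σ_{q ∈ S_c(x)} H(q̃ x)^{−m}` (the maximiser ★ `exists_borelHeight_mul_eq_ciSup` is a term);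
  **`sum_inv_pow_le_of_inv_le_ciSup`** — UPPER BOUND ABOVE HEIGHT `c⁻¹`: if `c⁻¹ ≤ w₁(x)` then `Σ_{q ∈ S_c(x)} H(q̃ x)^{−m} ≤ w₁(x)^{−m}` (move to the maximiser `y = γ₀ x` by §1; there only the
  trivial coset is cut off, ★ `setOf_lt_borelHeight_subset_singleton`); `sum_inv_pow_le_card_mul` (`Σ ≤ #S_c(x) · c^{−m}` always).
* §3 (CM pair) **`exists_sum_inv_pow_le_mul_ciSup_inv_pow_cm (hc : 0 < c) (m) : ∃ C', ∀ x, Σ_{q ∈ S_c(x)} H(q̃ x)^{−m} ≤ C' · w₁(x)^{−m}`** (`C' = max 1 (C · c^{−2m})`, `C` the ★ uniform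
  multiplicity bound `exists_ncard_setOf_lt_borelHeight_le_cm`: below height `c⁻¹` use `Σ ≤ C c^{−m}` and `c^{m} < w₁^{−m}`), and the two-sided package
  **`exists_pos_forall_ciSup_inv_pow_le_sum_le_cm (m) : ∃ c₀ > 0, ∀ c, 0 < c → c < c₀ → ∃ C', ∀ x, w₁^{−m} ≤ Σ ≤ C'·w₁^{−m}`** (`c₀` = ★ covering constant
  `exists_pos_forall_lt_ciSup_borelHeight_mul_cm`).
* §4 BRIDGES TO P2's `supHeight` (★ `K2E1BLSpacesU2Defs` D5, indexed by `U(J₂)(F)` = ★ `Rational` and evaluated at `(x.out)⁻¹`): `ciSup_borelHeight_toAdelic_mul_eq` (`⨆_{ρ ∈ U(J₂)(F)} H(ι(ρ) y) =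
  ⨆_{γ ∈ G(F)} H(γ y)`), `quotientSubgroup_eq_arithmeticSubgroup` (`A_G = 1`), `ciSup_borelHeight_mul_out_inv_eq` (`⨆_γ H(γ · ([g].out)⁻¹) = ⨆_γ H(γ g⁻¹)`: `w₁` at the Mathlib
  representative of `[g] ∈ G(𝔸) ⧸ G(F)` is `w₁(g⁻¹)`).

HONEST LABEL.  Count-neutral helper of the BL-SPH-2 template (consumer: P2a `IotaBound` ∕ `iota` closed embedding, K2E4-p10); closes no socket; HC_CM is proved only modulo the 7
printed citations (2 remaining named inputs: hLiu418 = `stmt-HodgeConjecture-24832`, h413 = `stmt-HodgeConjecture-24833`) until rung 0 closes.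

## References
* [BernsteinLapid2019] J. Bernstein, E. Lapid, *On the meromorphic continuation of Eisenstein series*, J. Amer. Math. Soc. 37 (2024) (arXiv:1911.02342), §4 Claim 4 (p. 10).
* [MoeglinWaldspurger1995] C. Mœglin, J.-L. Waldspurger, *Spectral Decomposition and Eisenstein Series* (1995), I.2.1–I.2.2, I.2.13 (weighted `L²`).
* [Borel1963] A. Borel, *Some finiteness properties of adele groups over number fields*, Publ. Math. IHÉS 16 (1963), §5.
* [Garrett2018] P. Garrett, *Modern Analysis of Automorphic Forms by Example* (2018), §2.3 (reduction theory via heights).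
-/

set_option autoImplicit false
-- the mandated namespace repeats `HodgeConjecture.HodgeConjecture`, as in every `Theorems/*.lean` of this sub-problem
set_option linter.dupNamespace false

noncomputable section

open NumberField IsDedekindDomain Set
open scoped NNReal

namespace Summit.HodgeConjecture.HodgeConjecture.Cruxes.H413.K2E1BLIotaWeightBoundU2

open Literature.NumberTheory.Automorphic Literature.NumberTheory.Automorphic.UnitaryGroup AdelicGroupData
open Summit.HodgeConjecture.HodgeConjecture.Cruxes.H413.K2E1BLHeightCosetsU2
open Summit.HodgeConjecture.HodgeConjecture.Cruxes.H413.K2E1BLReductionCoveringU2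

section Generic

variable {F E : Type} [Field F] [NumberField F] [Field E] [NumberField E] [Algebra F E] {c : E ≃ₐ[F] E}

/-! ## §1 The fibre sum `Σ_{q ∈ S_c(x)} φ(H(q̃ x))` is `G(F)`-invariant -/

/-- `B(F)·((B(F)·a).out · b) = B(F)·(a b)` in `B(F)∖G(F)` (the chosen representative of `B(F)a` is `β a`, `β ∈ B(F)`). [cite: Garrett2018, §2.10] -/
theorem mk_out_mul (a b : (quasiSplit F E c 2).arithmeticSubgroup) :
    Quotient.mk (QuotientGroup.rightRel (arithmeticBorel F E c 2)) ((Quotient.mk (QuotientGroup.rightRel (arithmeticBorel F E c 2)) a).out * b) =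
      Quotient.mk (QuotientGroup.rightRel (arithmeticBorel F E c 2)) (a * b) := by
  have h : a * ((Quotient.mk (QuotientGroup.rightRel (arithmeticBorel F E c 2)) a).out)⁻¹ ∈ arithmeticBorel F E c 2 :=
    QuotientGroup.rightRel_apply.1 (Quotient.mk_out (s := QuotientGroup.rightRel (arithmeticBorel F E c 2)) a)
  refine Quotient.sound (QuotientGroup.rightRel_apply.2 ?_)
  simpa only [_root_.mul_inv_rev, mul_assoc, mul_inv_cancel_left] using h

/-- **THE FIBRE SUM IS `G(F)`-INVARIANT**: for `γ₁ ∈ G(F)` and any `φ`, `Σ_{q ∈ S_c(γ₁ y)} φ(H(q̃ · γ₁ y)) = Σ_{q ∈ S_c(y)} φ(H(q̃ · y))`, `S_c(x) = {q ∣ c < H(q̃ x)}` — reindex along the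
bijection `q ↦ B(F)·(q̃ γ₁)` of `B(F)∖G(F)` (inverse `p ↦ B(F)·(p̃ γ₁⁻¹)`), under which `H(q̃ · γ₁ y) = H((B(F)·q̃γ₁).out · y)` (★ `borelHeight_out_mk_mul_two`).  So the fibre weight of
`p_c : Z_c → 𝔛` is a function on `𝔛`. [cite: BernsteinLapid2019, §4 Claim 4 (p. 10)] -/
theorem sum_setOf_lt_borelHeight_mul_eq {M : Type*} [AddCommMonoid M] (φ : ℝ≥0 → M) {c₀ : ℝ≥0} (hc : 0 < c₀)
    (γ₁ : (quasiSplit F E c 2).arithmeticSubgroup) (y : (quasiSplit F E c 2).Adelic) :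
    ∑ q ∈ (finite_setOf_lt_borelHeight_two (((γ₁ : (quasiSplit F E c 2).Adelic) * y)) hc).toFinset,
        φ (borelHeight (((q.out : (quasiSplit F E c 2).arithmeticSubgroup) : (quasiSplit F E c 2).Adelic) * (((γ₁ : (quasiSplit F E c 2).Adelic) * y)))) =
      ∑ q ∈ (finite_setOf_lt_borelHeight_two y hc).toFinset,
        φ (borelHeight (((q.out : (quasiSplit F E c 2).arithmeticSubgroup) : (quasiSplit F E c 2).Adelic) * y)) := by
  classical
  -- the key computation: `H(q̃ · γ₁ y) = H((B·q̃γ₁).out · y)`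
  have hkey : ∀ q : Quotient (QuotientGroup.rightRel (arithmeticBorel F E c 2)),
      borelHeight (((q.out : (quasiSplit F E c 2).arithmeticSubgroup) : (quasiSplit F E c 2).Adelic) * (((γ₁ : (quasiSplit F E c 2).Adelic) * y))) =
        borelHeight ((((Quotient.mk (QuotientGroup.rightRel (arithmeticBorel F E c 2)) (q.out * γ₁)).out :
          (quasiSplit F E c 2).arithmeticSubgroup) : (quasiSplit F E c 2).Adelic) * y) := fun q => by
    rw [borelHeight_out_mk_mul_two, Subgroup.coe_mul, mul_assoc]
  have hkey' : ∀ p : Quotient (QuotientGroup.rightRel (arithmeticBorel F E c 2)),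
      borelHeight ((((Quotient.mk (QuotientGroup.rightRel (arithmeticBorel F E c 2)) (p.out * γ₁⁻¹)).out :
          (quasiSplit F E c 2).arithmeticSubgroup) : (quasiSplit F E c 2).Adelic) * (((γ₁ : (quasiSplit F E c 2).Adelic) * y))) =
        borelHeight (((p.out : (quasiSplit F E c 2).arithmeticSubgroup) : (quasiSplit F E c 2).Adelic) * y) := fun p => by
    rw [borelHeight_out_mk_mul_two, Subgroup.coe_mul, Subgroup.coe_inv, mul_assoc, inv_mul_cancel_left]
  refine Finset.sum_bij' (fun q _ => Quotient.mk (QuotientGroup.rightRel (arithmeticBorel F E c 2)) (q.out * γ₁))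
    (fun p _ => Quotient.mk (QuotientGroup.rightRel (arithmeticBorel F E c 2)) (p.out * γ₁⁻¹)) ?_ ?_ ?_ ?_ ?_
  · intro q hq
    rw [Set.Finite.mem_toFinset] at hq ⊢
    show c₀ < _
    rw [← hkey]
    exact hq
  · intro p hp
    rw [Set.Finite.mem_toFinset] at hp ⊢
    show c₀ < _
    rw [hkey']
    exact hp
  · intro q _
    rw [mk_out_mul, mul_assoc, mul_inv_cancel, mul_one, Quotient.out_eq]
  · intro p _
    rw [mk_out_mul, mul_assoc, inv_mul_cancel, mul_one, Quotient.out_eq]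
  · intro q _
    rw [hkey]

/-! ## §2 Lower bound, and the upper bound above height `c⁻¹` (every `E ∕ F`) -/

/-- **LOWER BOUND**: if `c < w₁(x)` then `w₁(x)^{−m} ≤ Σ_{q ∈ S_c(x)} H(q̃ x)^{−m}` — the maximiser `γ₀` of `γ ↦ H(γ x)` (★ `exists_borelHeight_mul_eq_ciSup`) has `H(γ₀ x) = w₁(x) > c`, so
`B(F)γ₀ ∈ S_c(x)` contributes the term `w₁(x)^{−m}` (this is «`ι` has closed range ∕ is bounded below» once `c < c₀ ≤ w₁`). [cite: BernsteinLapid2019, §4 Claim 4 (p. 10)] -/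
theorem ciSup_inv_pow_le_sum_of_lt_ciSup {c₀ : ℝ≥0} (hc : 0 < c₀) (x : (quasiSplit F E c 2).Adelic)
    (hx : c₀ < ⨆ γ : (quasiSplit F E c 2).arithmeticSubgroup, borelHeight ((γ : (quasiSplit F E c 2).Adelic) * x)) (m : ℕ) :
    (⨆ γ : (quasiSplit F E c 2).arithmeticSubgroup, borelHeight ((γ : (quasiSplit F E c 2).Adelic) * x))⁻¹ ^ m ≤
      ∑ q ∈ (finite_setOf_lt_borelHeight_two x hc).toFinset,
        (borelHeight (((q.out : (quasiSplit F E c 2).arithmeticSubgroup) : (quasiSplit F E c 2).Adelic) * x))⁻¹ ^ m := by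
  classical
  obtain ⟨γ₀, hγ₀⟩ := exists_borelHeight_mul_eq_ciSup x
  have hmem : Quotient.mk (QuotientGroup.rightRel (arithmeticBorel F E c 2)) γ₀ ∈ (finite_setOf_lt_borelHeight_two x hc).toFinset := by
    rw [Set.Finite.mem_toFinset]
    show c₀ < _
    rw [borelHeight_out_mk_mul_two, hγ₀]
    exact hx
  have h := Finset.single_le_sum (f := fun q : Quotient (QuotientGroup.rightRel (arithmeticBorel F E c 2)) =>
      (borelHeight (((q.out : (quasiSplit F E c 2).arithmeticSubgroup) : (quasiSplit F E c 2).Adelic) * x))⁻¹ ^ m) (fun _ _ => bot_le) hmem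
  simp only [borelHeight_out_mk_mul_two, hγ₀] at h
  exact h

/-- **UPPER BOUND ABOVE HEIGHT `c⁻¹`** (Siegel property): if `c⁻¹ ≤ w₁(x)` then `Σ_{q ∈ S_c(x)} H(q̃ x)^{−m} ≤ w₁(x)^{−m}` — at the maximiser `y = γ₀ x` (`H(y) = w₁(x) ≥ c⁻¹`) only the trivial
coset can be cut off (★ `setOf_lt_borelHeight_subset_singleton`), and the fibre sum is `G(F)`-invariant (§1). [cite: BernsteinLapid2019, §4 (p. 9–10)] -/
theorem sum_inv_pow_le_of_inv_le_ciSup {c₀ : ℝ≥0} (hc : 0 < c₀) (x : (quasiSplit F E c 2).Adelic)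
    (hx : c₀⁻¹ ≤ ⨆ γ : (quasiSplit F E c 2).arithmeticSubgroup, borelHeight ((γ : (quasiSplit F E c 2).Adelic) * x)) (m : ℕ) :
    ∑ q ∈ (finite_setOf_lt_borelHeight_two x hc).toFinset,
        (borelHeight (((q.out : (quasiSplit F E c 2).arithmeticSubgroup) : (quasiSplit F E c 2).Adelic) * x))⁻¹ ^ m ≤
      (⨆ γ : (quasiSplit F E c 2).arithmeticSubgroup, borelHeight ((γ : (quasiSplit F E c 2).Adelic) * x))⁻¹ ^ m := by
  classical
  obtain ⟨γ₀, hγ₀⟩ := exists_borelHeight_mul_eq_ciSup x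
  set y := (γ₀ : (quasiSplit F E c 2).Adelic) * x with hy
  have hxy : x = ((γ₀⁻¹ : (quasiSplit F E c 2).arithmeticSubgroup) : (quasiSplit F E c 2).Adelic) * y := by
    rw [hy, Subgroup.coe_inv, inv_mul_cancel_left]
  have hyH : c₀⁻¹ ≤ borelHeight y := by rw [hy, hγ₀]; exact hx
  -- move to `y`
  have hsum := sum_setOf_lt_borelHeight_mul_eq (fun h : ℝ≥0 => h⁻¹ ^ m) hc γ₀⁻¹ y
  rw [← hxy] at hsum
  rw [hsum, ← hγ₀]
  -- at `y` only the trivial coset is cut off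
  have hsub : (finite_setOf_lt_borelHeight_two y hc).toFinset ⊆ {Quotient.mk (QuotientGroup.rightRel (arithmeticBorel F E c 2)) 1} := by
    intro q hq
    rw [Set.Finite.mem_toFinset] at hq
    rw [Finset.mem_singleton]
    exact mk_eq_of_lt_borelHeight hc hyH hq
  refine (Finset.sum_le_sum_of_subset hsub).trans (le_of_eq ?_)
  rw [Finset.sum_singleton, borelHeight_out_one_mul]

/-- **TRIVIAL UPPER BOUND BY THE COUNT**: `Σ_{q ∈ S_c(x)} H(q̃ x)^{−m} ≤ #S_c(x) · c^{−m}` (each cut-off term has `H(q̃ x) > c`). [cite: Garrett2018, §2.3] -/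
theorem sum_inv_pow_le_card_mul {c₀ : ℝ≥0} (hc : 0 < c₀) (x : (quasiSplit F E c 2).Adelic) (m : ℕ) :
    ∑ q ∈ (finite_setOf_lt_borelHeight_two x hc).toFinset,
        (borelHeight (((q.out : (quasiSplit F E c 2).arithmeticSubgroup) : (quasiSplit F E c 2).Adelic) * x))⁻¹ ^ m ≤
      (finite_setOf_lt_borelHeight_two x hc).toFinset.card * c₀⁻¹ ^ m := by
  classical
  have h : ∀ q ∈ (finite_setOf_lt_borelHeight_two x hc).toFinset,
      (borelHeight (((q.out : (quasiSplit F E c 2).arithmeticSubgroup) : (quasiSplit F E c 2).Adelic) * x))⁻¹ ^ m ≤ c₀⁻¹ ^ m := by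
    intro q hq
    rw [Set.Finite.mem_toFinset] at hq
    have hq' : c₀ < borelHeight (((q.out : (quasiSplit F E c 2).arithmeticSubgroup) : (quasiSplit F E c 2).Adelic) * x) := hq
    gcongr
  calc _ ≤ ∑ _q ∈ (finite_setOf_lt_borelHeight_two x hc).toFinset, c₀⁻¹ ^ m := Finset.sum_le_sum h
    _ = _ := by rw [Finset.sum_const, nsmul_eq_mul]

end Generic

/-! ## §3 The upper bound for the CM pair, and the two-sided package for P2a -/

section CM

variable (L : Type) [Field L] [NumberField L] [IsCMField L]

/-- **UPPER BOUND** (CM pair): for every `c > 0` and `m` there is `C'` with **`Σ_{q ∈ S_c(x)} H(q̃ x)^{−m} ≤ C' · w₁(x)^{−m}` for ALL `x`** — above height `c⁻¹` by the Siegel property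
(`sum_inv_pow_le_of_inv_le_ciSup`, constant `1`); below it `Σ ≤ C · c^{−m}` (★ uniform multiplicity bound `exists_ncard_setOf_lt_borelHeight_le_cm`, `sum_inv_pow_le_card_mul`) and
`c^{m} < w₁(x)^{−m}`, so `C' = max 1 (C · c^{−2m})` serves («`ι_{c,k}` is bounded», `m = 2k`). [cite: BernsteinLapid2019, §4 Claim 4 (p. 10)] [cite: MoeglinWaldspurger1995, I.2.2] -/
theorem exists_sum_inv_pow_le_mul_ciSup_inv_pow_cm {c₀ : ℝ≥0} (hc : 0 < c₀) (m : ℕ) :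
    ∃ C' : ℝ≥0, ∀ x : (quasiSplit (↥(maximalRealSubfield L)) L (IsCMField.complexConj L) 2).Adelic,
      ∑ q ∈ (finite_setOf_lt_borelHeight_two x hc).toFinset,
          (borelHeight (((q.out : (quasiSplit (↥(maximalRealSubfield L)) L (IsCMField.complexConj L) 2).arithmeticSubgroup) :
            (quasiSplit (↥(maximalRealSubfield L)) L (IsCMField.complexConj L) 2).Adelic) * x))⁻¹ ^ m ≤
        C' * (⨆ γ : (quasiSplit (↥(maximalRealSubfield L)) L (IsCMField.complexConj L) 2).arithmeticSubgroup,
          borelHeight ((γ : (quasiSplit (↥(maximalRealSubfield L)) L (IsCMField.complexConj L) 2).Adelic) * x))⁻¹ ^ m := by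
  classical
  obtain ⟨C, hC⟩ := exists_ncard_setOf_lt_borelHeight_le_cm L hc
  refine ⟨max 1 ((C : ℝ≥0) * (c₀⁻¹ ^ m * c₀⁻¹ ^ m)), fun x => ?_⟩
  set w := ⨆ γ : (quasiSplit (↥(maximalRealSubfield L)) L (IsCMField.complexConj L) 2).arithmeticSubgroup,
    borelHeight ((γ : (quasiSplit (↥(maximalRealSubfield L)) L (IsCMField.complexConj L) 2).Adelic) * x) with hw
  have hwpos : 0 < w := ciSup_borelHeight_mul_pos x
  rcases le_or_gt c₀⁻¹ w with hxw | hxw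
  · -- above height `c⁻¹`: the Siegel property
    calc _ ≤ w⁻¹ ^ m := sum_inv_pow_le_of_inv_le_ciSup hc x hxw m
      _ = 1 * w⁻¹ ^ m := (one_mul _).symm
      _ ≤ _ := by gcongr; exact le_max_left _ _
  · -- below height `c⁻¹`: the count
    have hcard : ((finite_setOf_lt_borelHeight_two x hc).toFinset.card : ℝ≥0) ≤ C := by
      rw [← Set.ncard_eq_toFinset_card _ (finite_setOf_lt_borelHeight_two x hc)]
      exact_mod_cast hC x
    have hcw : c₀ ≤ w⁻¹ := by
      rw [le_inv_comm₀ hc hwpos]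
      exact hxw.le
    calc _ ≤ ((finite_setOf_lt_borelHeight_two x hc).toFinset.card : ℝ≥0) * c₀⁻¹ ^ m := sum_inv_pow_le_card_mul hc x m
      _ ≤ C * c₀⁻¹ ^ m := by gcongr
      _ = (C : ℝ≥0) * (c₀⁻¹ ^ m * c₀⁻¹ ^ m) * c₀ ^ m := by
          rw [mul_assoc, mul_assoc, ← mul_pow c₀⁻¹ c₀, inv_mul_cancel₀ hc.ne', one_pow, mul_one]
      _ ≤ max 1 ((C : ℝ≥0) * (c₀⁻¹ ^ m * c₀⁻¹ ^ m)) * w⁻¹ ^ m := by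
          gcongr
          exact le_max_right _ _

/-- **THE TWO-SIDED PACKAGE FOR P2a** (CM pair): there is `c₀ > 0` (the ★ covering constant `exists_pos_forall_lt_ciSup_borelHeight_mul_cm`: `c₀ < w₁`) such that for every `0 < c < c₀` and
every `m` some `C'` gives, for ALL `x`, **`w₁(x)^{−m} ≤ Σ_{q ∈ S_c(x)} H(q̃ x)^{−m} ≤ C' · w₁(x)^{−m}`** — with `m = 2k` these are the fibrewise inequalities making
`ι_{c,k} : 𝓗_k(𝔛) → 𝓗_k(Z_c)` bounded with closed range (B–L Claim 4 bullet 1). [cite: BernsteinLapid2019, §4 Claim 4 (p. 10)] [cite: Borel1963, §5] -/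
theorem exists_pos_forall_ciSup_inv_pow_le_sum_le_cm (m : ℕ) :
    ∃ c₁ : ℝ≥0, 0 < c₁ ∧ ∀ c₀ : ℝ≥0, ∀ hc : 0 < c₀, c₀ < c₁ → ∃ C' : ℝ≥0,
      ∀ x : (quasiSplit (↥(maximalRealSubfield L)) L (IsCMField.complexConj L) 2).Adelic,
        (⨆ γ : (quasiSplit (↥(maximalRealSubfield L)) L (IsCMField.complexConj L) 2).arithmeticSubgroup,
            borelHeight ((γ : (quasiSplit (↥(maximalRealSubfield L)) L (IsCMField.complexConj L) 2).Adelic) * x))⁻¹ ^ m ≤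
          ∑ q ∈ (finite_setOf_lt_borelHeight_two x hc).toFinset,
            (borelHeight (((q.out : (quasiSplit (↥(maximalRealSubfield L)) L (IsCMField.complexConj L) 2).arithmeticSubgroup) :
              (quasiSplit (↥(maximalRealSubfield L)) L (IsCMField.complexConj L) 2).Adelic) * x))⁻¹ ^ m ∧
        ∑ q ∈ (finite_setOf_lt_borelHeight_two x hc).toFinset,
            (borelHeight (((q.out : (quasiSplit (↥(maximalRealSubfield L)) L (IsCMField.complexConj L) 2).arithmeticSubgroup) :
              (quasiSplit (↥(maximalRealSubfield L)) L (IsCMField.complexConj L) 2).Adelic) * x))⁻¹ ^ m ≤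
          C' * (⨆ γ : (quasiSplit (↥(maximalRealSubfield L)) L (IsCMField.complexConj L) 2).arithmeticSubgroup,
            borelHeight ((γ : (quasiSplit (↥(maximalRealSubfield L)) L (IsCMField.complexConj L) 2).Adelic) * x))⁻¹ ^ m := by
  obtain ⟨c₁, hc₁, hcov⟩ := exists_pos_forall_lt_ciSup_borelHeight_mul_cm L
  refine ⟨c₁, hc₁, fun c₀ hc hlt => ?_⟩
  obtain ⟨C', hC'⟩ := exists_sum_inv_pow_le_mul_ciSup_inv_pow_cm L hc m
  exact ⟨C', fun x => ⟨ciSup_inv_pow_le_sum_of_lt_ciSup hc x (hlt.trans (hcov x)) m, hC' x⟩⟩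

end CM

/-! ## §4 Bridges to P2's `supHeight` (`w₁` indexed by `U(J₂)(F)` and evaluated at `([g].out)⁻¹`) -/

section Bridges

variable {F E : Type} [Field F] [NumberField F] [Field E] [NumberField E] [Algebra F E] {c : E ≃ₐ[F] E}

/-- **`⨆_{ρ ∈ U(J₂)(F)} H(ι(ρ) y) = ⨆_{γ ∈ G(F)} H(γ y)`** — re-index along `ι : U(J₂)(F) → G(F) = ι(U(J₂)(F))` (surjective onto the arithmetic subgroup by definition); the left side is
★ `K2E1BLSpacesU2Defs.supHeight`'s spelling, the right side this file's. [cite: BernsteinLapid2019, §4 (p. 10)] -/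
theorem ciSup_borelHeight_toAdelic_mul_eq (y : (quasiSplit F E c 2).Adelic) :
    (⨆ ρ : (quasiSplit F E c 2).Rational, borelHeight ((quasiSplit F E c 2).toAdelic ρ * y)) =
      ⨆ γ : (quasiSplit F E c 2).arithmeticSubgroup, borelHeight ((γ : (quasiSplit F E c 2).Adelic) * y) := by
  have hsurj : Function.Surjective (fun ρ : (quasiSplit F E c 2).Rational =>
      (⟨(quasiSplit F E c 2).toAdelic ρ, ρ, rfl⟩ : (quasiSplit F E c 2).arithmeticSubgroup)) := by
    intro γ
    obtain ⟨ρ, hρ⟩ := γ.2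
    exact ⟨ρ, Subtype.ext hρ⟩
  rw [← hsurj.iSup_comp (fun γ : (quasiSplit F E c 2).arithmeticSubgroup => borelHeight ((γ : (quasiSplit F E c 2).Adelic) * y))]

omit [NumberField F] in
/-- **`A_G = 1` for `U(J_N)`**: the subgroup quotiented out in ★ `automorphicQuotient` is `G(F)` itself (`quotientSubgroup = ⊥ ⊔ arithmeticSubgroup`; Mok: the centre `U(1)` is
anisotropic). [cite: Mok2014, §1 Notation p. 5] -/
theorem quotientSubgroup_eq_arithmeticSubgroup {N : ℕ} [NumberField F] :
    (quasiSplit F E c N).quotientSubgroup = (quasiSplit F E c N).arithmeticSubgroup := by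
  show ⊥ ⊔ (quasiSplit F E c N).arithmeticSubgroup = (quasiSplit F E c N).arithmeticSubgroup
  exact bot_sup_eq _

/-- **`w₁` at the Mathlib representative**: `⨆_γ H(γ · ([g].out)⁻¹) = ⨆_γ H(γ · g⁻¹)` for the class `[g] ∈ G(𝔸) ⧸ G(F)` (★ `automorphicQuotient`; `[g].out = g γ'` with `γ' ∈ G(F)`, Mathlib
`QuotientGroup.mk_out_eq_mul`, and `w₁` is `G(F)`-invariant ★ `ciSup_borelHeight_mul_mul`) — so ★ `supHeight [g]` is `w₁(g⁻¹)` in this file's currency. [cite: BernsteinLapid2019, §4 (p. 10)] -/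
theorem ciSup_borelHeight_mul_out_inv_eq (g : (quasiSplit F E c 2).Adelic) :
    (⨆ γ : (quasiSplit F E c 2).arithmeticSubgroup, borelHeight ((γ : (quasiSplit F E c 2).Adelic) *
        (Quotient.out ((quasiSplit F E c 2).toAutomorphicQuotient g : (quasiSplit F E c 2).Adelic ⧸ (quasiSplit F E c 2).quotientSubgroup))⁻¹)) =
      ⨆ γ : (quasiSplit F E c 2).arithmeticSubgroup, borelHeight ((γ : (quasiSplit F E c 2).Adelic) * g⁻¹) := by
  obtain ⟨h, hh⟩ := QuotientGroup.mk_out_eq_mul (quasiSplit F E c 2).quotientSubgroup g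
  have hh' : Quotient.out ((quasiSplit F E c 2).toAutomorphicQuotient g : (quasiSplit F E c 2).Adelic ⧸ (quasiSplit F E c 2).quotientSubgroup) =
      g * (h : (quasiSplit F E c 2).Adelic) := hh
  have hmem : ((h : (quasiSplit F E c 2).Adelic))⁻¹ ∈ (quasiSplit F E c 2).arithmeticSubgroup := by
    rw [← quotientSubgroup_eq_arithmeticSubgroup]
    exact inv_mem h.2
  rw [hh', _root_.mul_inv_rev]
  exact ciSup_borelHeight_mul_mul ⟨_, hmem⟩ g⁻¹

end Bridges

end Summit.HodgeConjecture.HodgeConjecture.Cruxes.H413.K2E1BLIotaWeightBoundU2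

end
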